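import Summits.QuantumFields.GaugeBoot.StapleSplit
import Summits.QuantumFields.GaugeBoot.LinkResampling
import Summits.QuantumFields.GaugeBoot.WordLoop
import HarnessLib

/-!
# Gauge-boot: the a-priori BESSEL CAP on torus Wilson-loop expectations of `SU(2)`

Cell `ym-instrument` (HOME `run/shared/lean/pub/ym-instrument/`), crew (a), seat `ym-instrument-boot-lean-1`;
A-plan-11 «BESSEL CAP» typing, file 5/6 — THE THEOREM (boot-plan AMEND-A-plan-10-BESSEL-CAP.md §1, proof refereed
by boot-ref as LIMIT-SOUNDNESS P.5, PASS 2026-08-26T22:45:31Z; constant of record A-plan-11 v2 §2).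

HONEST FRAMING (page 1 of every file of this cell): WHAT IS CERTIFIED HERE AND AT WHICH `(G, D, L, β)`: for
`G = SU(2)` in the fundamental representation, standard Wilson action at tree coupling `t = β_std/2 ≥ 0`, on EVERY torus
`(ℤ/L)^d` with `L ≥ 2` and every `d`: if a lattice word `w` (read from `x`) traverses each edge of a finite set `F`
EXACTLY ONCE and no two edges of `F` lie in a common plaquette, then `|⟨W_x(w)⟩| ≤ ρ^{|F|}` for every `ρ ≥ 0` with
`I₂(x)/I₁(x) ≤ ρ` on `0 < x ≤ 2t·2(d-1)` (`abs_wilsonExpectation_wordLoop_le_pow`). This is an elementary, fixed-coupling,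
`R`-INDEPENDENT perimeter-type bound (an explicit-rate `SU(2)` instance of Simon–Yaffe, Phys. Lett. 115B (1982) 145);
it says nothing about confinement, an area law, a string tension, a mass gap or any continuum limit, and is not
summit-bearing. Its use in the cell: it removes the named hypothesis `hBesselCap(ρ)` from the «| cap» rows of Q-A1
once the per-row instance (file 6, `Instrument/BesselCapSU2D4`) is landed.

## The proof (Creutz's heat bath, one link at a time; no Fubini over `G^F`)

For a list `fs = [e₁, …, e_k]` of admissible edges define recursively the substituted configuration
`capConfig fs U` (each `e_i` replaced by `V_{e_i}(U)⁻¹`, `V_e(U) = quatToSU2 (k_e U)` the direction of the staple sum)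
and the weight `capWeight t fs U = ∏ linkMean(t‖k_{e_i}(U)‖)`; the observable
`capObs t x w fs U = capWeight · W_x(w)(capConfig fs U)` satisfies
(i) `⟨capObs fs⟩_t = ⟨capObs (e :: fs)⟩_t` — the one-link integrals of `e^{-tS} · capObs` agree at every configuration
(`LinkResampling.wilsonExpectation_eq_of_integral_update_eq`; the action is `far + Re tr(g·K_e)` by `StapleSplit`, the
loop is `½ Re tr(g · staple)` by `WordUpdate`, and the one-link mean is `linkMean(t‖k‖)·V⁻¹` by `SU2OneLinkMean`);
(ii) `|capObs fs| ≤ ρ^{|fs|}` pointwise (`0 ≤ linkMean ≤ ρ`, `|W| ≤ 1`). Hence `⟨W_x(w)⟩ = ⟨capObs F⟩` is bounded by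
`ρ^{|F|}`.
-/

noncomputable section

open MeasureTheory Complex Function
open Literature.MathematicalPhysics.QuantumFieldTheory
open Literature.MathematicalPhysics.QuantumLattice (quatMatrix quatToSU2 su2Quat measurable_quatToSU2
  secondCountableTopology_su2)
open Literature.Analysis.FunctionSpaces (besselI)

attribute [local instance] Literature.Analysis.FluidPDE.Tao2016.quatMeasurableSpace
  Literature.Analysis.FluidPDE.Tao2016.quatBorelSpace
  Literature.MathematicalPhysics.QuantumLattice.secondCountableTopology_su2

namespace Summit.QuantumFields.GaugeBoot

namespace BesselCap

variable {d L : ℕ} [NeZero L]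

/-! ## The substituted configuration and the weight -/

/-- The DIRECTION of the staple sum of `e`: `V_e(U) = quatToSU2 (k_e U) ∈ SU(2)` (junk `1` when `k_e U = 0`). [folklore] -/
def linkDir (e : Edge d L) (U : GaugeConfig d L (SU 2)) : SU 2 := quatToSU2 (stapleSum e U)

/-- The conditional-mean MAGNITUDE of the link `e`: `s_e(U) = linkMean(t‖k_e U‖) = I₂/I₁(2t‖k_e U‖)`. [folklore] -/
def linkFactor (t : ℝ) (e : Edge d L) (U : GaugeConfig d L (SU 2)) : ℝ := SU2OneLink.linkMean (t * ‖stapleSum e U‖)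

/-- The substituted configuration: the links of the list replaced by the inverses of their staple directions. [folklore] -/
def capConfig : List (Edge d L) → GaugeConfig d L (SU 2) → GaugeConfig d L (SU 2)
  | [], U => U
  | e :: fs, U => update (capConfig fs U) e (linkDir e U)⁻¹

/-- The product of the conditional-mean magnitudes of the links of the list. [folklore] -/
def capWeight (t : ℝ) : List (Edge d L) → GaugeConfig d L (SU 2) → ℝ
  | [], _ => 1
  | e :: fs, U => linkFactor t e U * capWeight t fs U

/-- The observable after integrating out the links of the list: `capWeight · W_x(w)(capConfig)`. [folklore] -/
def capObs (t : ℝ) (x : Site d L) (w : Word d) (fs : List (Edge d L)) (U : GaugeConfig d L (SU 2)) : ℝ :=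
  capWeight t fs U * wordLoop (suRep 2) x w (capConfig fs U)

/-- With no link integrated out the observable is the loop itself. [folklore] -/
theorem capObs_nil (t : ℝ) (x : Site d L) (w : Word d) : capObs t x w [] = wordLoop (suRep 2) x w := by
  funext U; simp [capObs, capWeight, capConfig]

/-! ## Invariance under resampling a link -/

/-- `V_e` does not read `e`. [folklore] -/
theorem linkDir_update_self (e : Edge d L) (U : GaugeConfig d L (SU 2)) (g : SU 2) :
    linkDir e (update U e g) = linkDir e U := by
  unfold linkDir; rw [stapleSum_update_self]

/-- `s_e` does not read `e`. [folklore] -/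
theorem linkFactor_update_self (t : ℝ) (e : Edge d L) (U : GaugeConfig d L (SU 2)) (g : SU 2) :
    linkFactor t e (update U e g) = linkFactor t e U := by
  unfold linkFactor; rw [stapleSum_update_self]

/-- `V_{e'}` does not read an edge `e` sharing no plaquette with `e'`. [folklore] -/
theorem linkDir_update_of_not_share {e' e : Edge d L} (h : ¬ SharePlaquette e' e) (U : GaugeConfig d L (SU 2))
    (g : SU 2) : linkDir e' (update U e g) = linkDir e' U := by
  unfold linkDir; rw [stapleSum_update_of_not_share h]

/-- `s_{e'}` does not read an edge `e` sharing no plaquette with `e'`. [folklore] -/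
theorem linkFactor_update_of_not_share (t : ℝ) {e' e : Edge d L} (h : ¬ SharePlaquette e' e)
    (U : GaugeConfig d L (SU 2)) (g : SU 2) : linkFactor t e' (update U e g) = linkFactor t e' U := by
  unfold linkFactor; rw [stapleSum_update_of_not_share h]

/-- Resampling a link outside the list commutes with the substitution. [folklore] -/
theorem capConfig_update {e : Edge d L} :
    ∀ {fs : List (Edge d L)}, e ∉ fs → (∀ e' ∈ fs, ¬ SharePlaquette e' e) →
      ∀ (U : GaugeConfig d L (SU 2)) (g : SU 2), capConfig fs (update U e g) = update (capConfig fs U) e g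
  | [], _, _, U, g => rfl
  | e' :: fs, hmem, hsh, U, g => by
    simp only [List.mem_cons, not_or] at hmem
    have ih := capConfig_update hmem.2 (fun f hf => hsh f (List.mem_cons_of_mem _ hf)) U g
    simp only [capConfig]
    rw [ih, linkDir_update_of_not_share (hsh e' List.mem_cons_self), update_comm (Ne.symm hmem.1)]

/-- The weight of a list not containing `e` (and not sharing a plaquette with it) does not read `e`. [folklore] -/
theorem capWeight_update (t : ℝ) {e : Edge d L} :
    ∀ {fs : List (Edge d L)}, (∀ e' ∈ fs, ¬ SharePlaquette e' e) →
      ∀ (U : GaugeConfig d L (SU 2)) (g : SU 2), capWeight t fs (update U e g) = capWeight t fs U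
  | [], _, U, g => rfl
  | e' :: fs, hsh, U, g => by
    simp only [capWeight]
    rw [capWeight_update t (fun f hf => hsh f (List.mem_cons_of_mem _ hf)) U g,
      linkFactor_update_of_not_share t (hsh e' List.mem_cons_self)]

/-- After `e` is substituted, the configuration no longer reads `e`. [folklore] -/
theorem capConfig_cons_update_self {e : Edge d L} {fs : List (Edge d L)} (hmem : e ∉ fs)
    (hsh : ∀ e' ∈ fs, ¬ SharePlaquette e' e) (U : GaugeConfig d L (SU 2)) (g : SU 2) :
    capConfig (e :: fs) (update U e g) = capConfig (e :: fs) U := by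
  simp only [capConfig]
  rw [capConfig_update hmem hsh, linkDir_update_self, update_idem]

/-! ## Pointwise bounds -/

/-- `|capWeight| ≤ 1`. [folklore] -/
theorem abs_capWeight_le_one (t : ℝ) : ∀ (fs : List (Edge d L)) (U : GaugeConfig d L (SU 2)),
    |capWeight t fs U| ≤ 1
  | [], U => by simp [capWeight]
  | e :: fs, U => by
    simp only [capWeight, abs_mul]
    exact mul_le_one₀ (SU2OneLink.abs_linkMean_le_one _) (abs_nonneg _) (abs_capWeight_le_one t fs U)

/-- `|capObs| ≤ 1`. [folklore] -/
theorem abs_capObs_le_one (t : ℝ) (x : Site d L) (w : Word d) (fs : List (Edge d L)) (U : GaugeConfig d L (SU 2)) :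
    |capObs t x w fs U| ≤ 1 := by
  unfold capObs
  rw [abs_mul]
  exact mul_le_one₀ (abs_capWeight_le_one t fs U) (abs_nonneg _)
    (abs_wordLoop_le_one (suRep 2) (continuous_suRep 2) x w _)

/-- **The cap on one factor**: `0 ≤ s_e(U) ≤ ρ` whenever `t ≥ 0` and `I₂/I₁ ≤ ρ` on `(0, 2t·2(d-1)]`. [folklore] -/
theorem linkFactor_mem_Icc {t ρ : ℝ} (ht : 0 ≤ t) (hρ : 0 ≤ ρ)
    (hX : ∀ y : ℝ, 0 < y → y ≤ 2 * t * ((2 * (d - 1) : ℕ) : ℝ) → besselI 2 y / besselI 1 y ≤ ρ)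
    (e : Edge d L) (U : GaugeConfig d L (SU 2)) : 0 ≤ linkFactor t e U ∧ linkFactor t e U ≤ ρ := by
  have hB : 0 ≤ t * ‖stapleSum e U‖ := mul_nonneg ht (norm_nonneg _)
  refine ⟨SU2OneLink.linkMean_nonneg hB, SU2OneLink.linkMean_le_of_besselRatio_le hρ hX hB ?_⟩
  have h := norm_stapleSum_le e U
  nlinarith

/-- `0 ≤ capWeight ≤ ρ^{|fs|}` under the cap hypothesis. [folklore] -/
theorem capWeight_mem_Icc {t ρ : ℝ} (ht : 0 ≤ t) (hρ : 0 ≤ ρ)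
    (hX : ∀ y : ℝ, 0 < y → y ≤ 2 * t * ((2 * (d - 1) : ℕ) : ℝ) → besselI 2 y / besselI 1 y ≤ ρ) :
    ∀ (fs : List (Edge d L)) (U : GaugeConfig d L (SU 2)), 0 ≤ capWeight t fs U ∧ capWeight t fs U ≤ ρ ^ fs.length
  | [], U => by simp [capWeight]
  | e :: fs, U => by
    obtain ⟨h0, h1⟩ := linkFactor_mem_Icc ht hρ hX e U
    obtain ⟨h2, h3⟩ := capWeight_mem_Icc ht hρ hX fs U
    simp only [capWeight, List.length_cons, pow_succ]
    refine ⟨mul_nonneg h0 h2, ?_⟩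
    rw [mul_comm (ρ ^ fs.length)]
    exact mul_le_mul h1 h3 h2 hρ

/-- **Pointwise cap**: `|capObs t x w fs U| ≤ ρ^{|fs|}`. [folklore] -/
theorem abs_capObs_le_pow {t ρ : ℝ} (ht : 0 ≤ t) (hρ : 0 ≤ ρ)
    (hX : ∀ y : ℝ, 0 < y → y ≤ 2 * t * ((2 * (d - 1) : ℕ) : ℝ) → besselI 2 y / besselI 1 y ≤ ρ)
    (x : Site d L) (w : Word d) (fs : List (Edge d L)) (U : GaugeConfig d L (SU 2)) :
    |capObs t x w fs U| ≤ ρ ^ fs.length := by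
  obtain ⟨h0, h1⟩ := capWeight_mem_Icc ht hρ hX fs U
  unfold capObs
  rw [abs_mul, abs_of_nonneg h0]
  calc capWeight t fs U * |wordLoop (suRep 2) x w (capConfig fs U)| ≤ ρ ^ fs.length * 1 :=
        mul_le_mul h1 (abs_wordLoop_le_one (suRep 2) (continuous_suRep 2) x w _) (abs_nonneg _)
          (pow_nonneg hρ _)
    _ = ρ ^ fs.length := mul_one _

/-! ## Measurability -/

/-- The staple direction is a measurable function of the configuration. [folklore] -/
theorem measurable_linkDir (e : Edge d L) : Measurable (linkDir (d := d) (L := L) e) :=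
  measurable_quatToSU2.comp (continuous_stapleSum e).measurable

/-- The substituted configuration is a measurable function of the configuration. [folklore] -/
theorem measurable_capConfig : ∀ fs : List (Edge d L), Measurable (capConfig (d := d) (L := L) fs)
  | [] => measurable_id
  | e :: fs => by
    change Measurable fun U => update (capConfig fs U) e (linkDir e U)⁻¹
    exact measurable_update'.comp ((measurable_capConfig fs).prodMk (measurable_linkDir e).inv)

/-- The weight is a continuous function of the configuration. [folklore] -/
theorem continuous_capWeight (t : ℝ) : ∀ fs : List (Edge d L), Continuous (capWeight (d := d) (L := L) t fs)
  | [] => continuous_const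
  | e :: fs => by
    change Continuous fun U => linkFactor t e U * capWeight t fs U
    exact (SU2OneLink.continuous_linkMean.comp
      (continuous_const.mul (continuous_norm.comp (continuous_stapleSum e)))).mul (continuous_capWeight t fs)

/-- `capObs` is measurable. [folklore] -/
theorem measurable_capObs (t : ℝ) (x : Site d L) (w : Word d) (fs : List (Edge d L)) :
    Measurable (capObs (d := d) (L := L) t x w fs) :=
  (continuous_capWeight t fs).measurable.mul
    ((measurable_wordLoop (suRep 2) (continuous_suRep 2) x w).comp (measurable_capConfig fs))

/-! ## The one-link step: integrating out one more admissible link does not change the expectation -/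

omit [NeZero L] in
/-- The loop variable with one link replaced: `W_x(w)(C[e ↦ g]) = ½ Re tr(g · staple)` for a word reading `e` exactly
once (file `WordUpdate`). [folklore] -/
theorem wordLoop_update_eq {x : Site d L} {w : Word d} {e : Edge d L} (S : Word.Split x w e)
    (C : GaugeConfig d L (SU 2)) (g : SU 2) :
    wordLoop (suRep 2) x w (update C e g) = 1 / 2 * ((g * S.staple C).1.trace).re := by
  rw [wordLoop_apply, S.re_trace_wordHolonomy_update (suRep 2) (continuous_suRep 2) C g]
  change ((2 : ℕ) : ℝ)⁻¹ * ((g * S.staple C).1.trace).re = _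
  norm_num

/-- **THE ONE-LINK STEP.** For `L ≥ 2`, a word `w` reading the edge `e` exactly once, and a list `fs` of edges not
containing `e` and sharing no plaquette with `e`: `⟨capObs fs⟩_t = ⟨capObs (e :: fs)⟩_t`. [folklore] -/
theorem wilsonExpectation_capObs_cons (hL : 1 < L) (t : ℝ) (x : Site d L) (w : Word d) {e : Edge d L}
    {fs : List (Edge d L)} (he : (Word.edgesRead x w).count e = 1) (hmem : e ∉ fs)
    (hsh : ∀ e' ∈ fs, ¬ SharePlaquette e' e) :
    wilsonExpectation (suRep 2) t (capObs t x w fs) = wilsonExpectation (suRep 2) t (capObs t x w (e :: fs)) := by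
  classical
  refine wilsonExpectation_eq_of_integral_update_eq (suRep 2) (continuous_suRep 2) t e
    (measurable_capObs t x w fs) (measurable_capObs t x w (e :: fs)) ⟨1, abs_capObs_le_one t x w fs⟩
    ⟨1, abs_capObs_le_one t x w (e :: fs)⟩ fun U => ?_
  -- names
  set S := Word.split x w e he with hS
  set C := capConfig fs U with hC
  set k := stapleSum e U with hk
  set cW := capWeight t fs U with hcW
  set R := Real.exp (-t * farAction (suRep 2) e U) with hR
  -- the two integrands in closed form
  have hlhs : ∀ g : SU 2, Real.exp (-t * wilsonAction (suRep 2) (update U e g)) * capObs t x w fs (update U e g) =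
      (R * cW) * (1 / 2 * ((g * S.staple C).1.trace).re * Real.exp (t * (g.1 * quatMatrix k).trace.re)) := by
    intro g
    rw [exp_neg_mul_wilsonAction_update hL t e U g, capObs, capWeight_update t hsh, capConfig_update hmem hsh,
      wordLoop_update_eq S]
    ring
  have hrhs : ∀ g : SU 2, Real.exp (-t * wilsonAction (suRep 2) (update U e g)) * capObs t x w (e :: fs) (update U e g) =
      (linkFactor t e U * cW * (1 / 2 * (((linkDir e U)⁻¹ * S.staple C).1.trace).re) * R) *
        Real.exp (t * (g.1 * quatMatrix k).trace.re) := by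
    intro g
    rw [exp_neg_mul_wilsonAction_update hL t e U g, capObs, capConfig_cons_update_self hmem hsh]
    simp only [capWeight, capConfig]
    rw [linkFactor_update_self, capWeight_update t hsh, wordLoop_update_eq S]
    ring
  simp_rw [hlhs, hrhs]
  rw [integral_const_mul, integral_const_mul, SU2OneLink.integral_half_re_trace_mul_exp_source t k (S.staple C)]
  simp only [linkFactor, linkDir, hk]
  ring

/-- **The expectation of the loop equals the expectation of the substituted observable**, for every admissible list:
no repeated edge, each edge read exactly once by the word, no two sharing a plaquette. [folklore] -/
theorem wilsonExpectation_wordLoop_eq_capObs (hL : 1 < L) (t : ℝ) (x : Site d L) (w : Word d) :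
    ∀ (fs : List (Edge d L)), fs.Nodup → (∀ e ∈ fs, (Word.edgesRead x w).count e = 1) →
      fs.Pairwise (fun e e' => ¬ SharePlaquette e e') →
        wilsonExpectation (suRep 2) t (wordLoop (suRep 2) x w) = wilsonExpectation (suRep 2) t (capObs t x w fs)
  | [], _, _, _ => by rw [capObs_nil]
  | e :: fs, hnd, hread, hpw => by
    rw [List.nodup_cons] at hnd
    rw [List.pairwise_cons] at hpw
    have hsh : ∀ e' ∈ fs, ¬ SharePlaquette e' e := fun e' he' hshare =>
      hpw.1 e' he' (by obtain ⟨p, h1, h2⟩ := hshare; exact ⟨p, h2, h1⟩)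
    rw [wilsonExpectation_wordLoop_eq_capObs hL t x w fs hnd.2 (fun f hf => hread f (List.mem_cons_of_mem _ hf)) hpw.2]
    exact wilsonExpectation_capObs_cons hL t x w (hread e List.mem_cons_self) hnd.1 hsh

end BesselCap

open BesselCap

variable {d L : ℕ} [NeZero L]

/-- **THE BESSEL CAP (a-priori perimeter-type bound on `SU(2)` Wilson-loop expectations; boot-plan A-plan-10 §1 /
A-plan-11, refereed boot-ref LIMIT-SOUNDNESS P.5; an explicit-rate `SU(2)` instance of the Simon–Yaffe perimeter-law upper
bound, Phys. Lett. 115B (1982) 145, via Creutz's one-link heat-bath mean, Phys. Rev. D 21 (1980) 2308 §III).**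
`G = SU(2)`, fundamental representation, the tree's Wilson state `wilsonMeasure (suRep 2) t` on the torus `(ℤ/L)^d` with
`L ≥ 2` at tree coupling `t ≥ 0` (standard Wilson coupling `β_std = 2t`). Let `w` be a lattice word read from `x` and `F`
a finite set of edges such that (i) `w` traverses every edge of `F` EXACTLY ONCE and (ii) no two distinct edges of `F`
are read by a common plaquette. Then for every `ρ ≥ 0` with `I₂(y)/I₁(y) ≤ ρ` for all `0 < y ≤ 2t · 2(d-1)`,
`|⟨W_x(w)⟩_t| ≤ ρ ^ |F|`.
HONEST FRAMING: a fixed-coupling, `R`-independent bound valid on every torus `L ≥ 2`; not an area law, not a mass gap,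
nothing about a continuum limit; not summit-bearing. [folklore] -/
theorem abs_wilsonExpectation_wordLoop_le_pow (hL : 1 < L) {t : ℝ} (ht : 0 ≤ t) (x : Site d L) (w : Word d)
    (F : Finset (Edge d L)) (hF1 : ∀ e ∈ F, (Word.edgesRead x w).count e = 1)
    (hF2 : ∀ e ∈ F, ∀ e' ∈ F, e ≠ e' → ¬ SharePlaquette e e') {ρ : ℝ} (hρ : 0 ≤ ρ)
    (hX : ∀ y : ℝ, 0 < y → y ≤ 2 * t * ((2 * (d - 1) : ℕ) : ℝ) → besselI 2 y / besselI 1 y ≤ ρ) :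
    |wilsonExpectation (suRep 2) t (wordLoop (suRep 2) x w)| ≤ ρ ^ F.card := by
  classical
  haveI := isProbabilityMeasure_wilsonMeasure (d := d) (L := L) (G := SU 2) (suRep 2) (continuous_suRep 2) t
  set fs := F.toList with hfs
  have hnd : fs.Nodup := F.nodup_toList
  have hread : ∀ e ∈ fs, (Word.edgesRead x w).count e = 1 := fun e he => hF1 e (Finset.mem_toList.1 he)
  have hpw : fs.Pairwise (fun e e' => ¬ SharePlaquette e e') :=
    hnd.pairwise_of_forall_ne fun a ha b hb hab => hF2 a (Finset.mem_toList.1 ha) b (Finset.mem_toList.1 hb) hab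
  rw [wilsonExpectation_wordLoop_eq_capObs hL t x w fs hnd hread hpw, ← Finset.length_toList, ← hfs]
  unfold wilsonExpectation
  have h := norm_integral_le_of_norm_le_const (μ := wilsonMeasure (suRep 2) t) (f := capObs t x w fs)
    (C := ρ ^ fs.length) (Filter.Eventually.of_forall fun U => by
      rw [Real.norm_eq_abs]; exact abs_capObs_le_pow ht hρ hX x w fs U)
  rwa [probReal_univ, mul_one, Real.norm_eq_abs] at h

end Summit.QuantumFields.GaugeBoot

end
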